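import Literature.LinearAlgebra.Matrix.MinkowskiDet
import Mathlib.Analysis.MeanInequalities
import Mathlib.Analysis.SpecialFunctions.Pow.Real
import Mathlib.Analysis.SpecialFunctions.Log.Basic
import Mathlib.Analysis.Convex.Function
import HarnessLib

/-!
# Ky Fan's determinant inequality and the concavity of `log det` (Horn–Johnson 7.6.6 / 7.6.8)

REVISION (eng-sdp-2 gen 48, 2026-08-23; owner DEDUP ERRATUM): the first edition of this file
re-proved Minkowski's determinant inequality (as `LogDet.det_rpow_add_det_rpow_le`, positive
definite hypotheses) and reached Corollary 7.6.8 through its own spectral-theorem core; both were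
already in the tree in stronger form (`Literature/LinearAlgebra/Matrix/MinkowskiDet.lean`:
`Literature.LinearAlgebra.Matrix.det_rpow_add_det_rpow_le` for `A, B ⪰ 0`, `det_smul_rpow`,
`concaveOn_det_rpow`).  This edition IMPORTS that file, deletes the duplicate, and upgrades every
statement here to positive SEMIdefinite hypotheses where meaningful; the surviving declaration
names are unchanged (`det_rpow_mul_det_rpow_le`, `rpow_det_le_det_convexCombo_one`,
`sqrt_det_mul_det_le`, `convex_setOf_posDef`, `concaveOn_log_det`, `det_add_det_le_det_add`).

For real symmetric matrices of size `N`: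

* **Horn–Johnson Corollary 7.6.8, (7.6.9a)** (Ky Fan): for `A, B ⪰ 0` and `0 ≤ α ≤ 1`,
  `det(αA + (1 − α)B) ≥ (det A)^α (det B)^{1−α}` — `det_rpow_mul_det_rpow_le`;
  the case `α = 1/2`, (7.6.9b): `det((A + B)/2) ≥ √(det A · det B)` — `sqrt_det_mul_det_le`.
* **Horn–Johnson Theorem 7.6.6, (7.6.7)**: `A ↦ log det A` is concave on the (convex,
  Observation 7.1.3) set of positive definite matrices — `concaveOn_log_det`,
  `convex_setOf_posDef`.  (The book's strictness clause is not formalised.)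
* the superadditivity `det A + det B ≤ det(A + B)` for `A, B ⪰ 0`, `N ≥ 1` (the exercise after
  Horn–Johnson Theorem 7.8.21, from (7.8.22)) — `det_add_det_le_det_add`.

Nothing here re-proves Minkowski's determinant inequality (7.8.22): it is the in-tree
`Literature.LinearAlgebra.Matrix.det_rpow_add_det_rpow_le` (file `MinkowskiDet.lean`, with
`det_smul_rpow`, `det_le_det_add_of_posSemidef`, `concaveOn_det_rpow`), which this file IMPORTS:
Ky Fan's inequality is obtained from Minkowski applied to `αA` and `(1 − α)B`, homogeneity and the
weighted arithmetic–geometric mean inequality (`Real.geom_mean_le_arith_mean2_weighted`), then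
`log` of both sides gives Theorem 7.6.6.  (Horn–Johnson prove 7.6.6 first, by simultaneous
diagonalisation, and list Minkowski as a consequence; the logical content is the same.)  The
first-order form of the concavity of `log det` (`log det W' − log det W ≤ tr(W⁻¹W') − N`) is the
in-tree `Literature.LinearAlgebra.Matrix.log_det_sub_log_det_le`
(`ChordalMaximumDeterminantCompletion.lean`); the present file adds the zeroth-order (Jensen) form
and Ky Fan's multiplicative form, which Mathlib and the tree did not have
(`lean search 'ConcaveOn.*det|det_rpow|geom_mean.*det|KyFan'`).

Engines note (eng-sdp-2, certsdp reader lane): these are the published facts behind the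
well-posedness words of log-barrier / maximum-determinant arguments cited by the SDP lanes
(shared numerical engines serving client cells; rigour lives in the verifiers; every published
number belongs to a client cell's ledger, not to the engines group); nothing here is numerical.

## References
* R. A. Horn, C. R. Johnson, *Matrix Analysis*, 2nd ed., Cambridge University Press (2013),
  Observation 7.1.3, Theorem 7.6.6, Corollary 7.6.8, Theorem 7.8.21 (exercise). [HornJohnson2013]
* S. Boyd, L. Vandenberghe, *Convex Optimization*, Cambridge University Press (2004), §3.1.5
  (`log det` is concave on `S^n_{++}`). [BoydVandenberghe2004]
-/

open Matrix Finset
open scoped MatrixOrder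

open Literature.LinearAlgebra.Matrix (det_rpow_add_det_rpow_le det_smul_rpow)

namespace Literature.Analysis.Matrix.LogDet

variable {n : Type*} [Fintype n] [DecidableEq n]

/-- Scalar core (private helper): if `α x^{1/k} + (1 − α) y^{1/k} ≤ z^{1/k}` for nonnegative reals
and `k ≥ 1`, then `x^α y^{1−α} ≤ z` (weighted AM–GM on the `k`-th roots, then `k`-th powers).
[folklore] -/
private theorem rpow_mul_rpow_le_of_roots {k : ℕ} (hk : k ≠ 0) {x y z α : ℝ} (hx : 0 ≤ x)
    (hy : 0 ≤ y) (hz : 0 ≤ z) (h0 : 0 ≤ α) (h1 : 0 ≤ 1 - α)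
    (h : α * x ^ (1 / (k : ℝ)) + (1 - α) * y ^ (1 / (k : ℝ)) ≤ z ^ (1 / (k : ℝ))) :
    x ^ α * y ^ (1 - α) ≤ z := by
  have hkpos : (0 : ℝ) < 1 / (k : ℝ) := one_div_pos.2 (Nat.cast_pos.2 (Nat.pos_of_ne_zero hk))
  have hxk : 0 ≤ x ^ (1 / (k : ℝ)) := Real.rpow_nonneg hx _
  have hyk : 0 ≤ y ^ (1 / (k : ℝ)) := Real.rpow_nonneg hy _
  have hAMGM : (x ^ (1 / (k : ℝ))) ^ α * (y ^ (1 / (k : ℝ))) ^ (1 - α) ≤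
      α * x ^ (1 / (k : ℝ)) + (1 - α) * y ^ (1 / (k : ℝ)) :=
    Real.geom_mean_le_arith_mean2_weighted (w₁ := α) (w₂ := 1 - α) h0 h1 hxk hyk (by ring)
  have hle := hAMGM.trans h
  have e1 : (x ^ (1 / (k : ℝ))) ^ α = (x ^ α) ^ (1 / (k : ℝ)) := by
    rw [← Real.rpow_mul hx, ← Real.rpow_mul hx, mul_comm]
  have e2 : (y ^ (1 / (k : ℝ))) ^ (1 - α) = (y ^ (1 - α)) ^ (1 / (k : ℝ)) := by
    rw [← Real.rpow_mul hy, ← Real.rpow_mul hy, mul_comm]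
  rw [e1, e2, ← Real.mul_rpow (Real.rpow_nonneg hx _) (Real.rpow_nonneg hy _)] at hle
  exact (Real.rpow_le_rpow_iff (mul_nonneg (Real.rpow_nonneg hx _) (Real.rpow_nonneg hy _)) hz
    hkpos).1 hle

/-- **Ky Fan's determinant inequality / Horn–Johnson Corollary 7.6.8, (7.6.9a)**
[cite: HornJohnson2013, Corollary 7.6.8 ((7.6.9a))]: for positive semidefinite real symmetric
`A, B` and `0 ≤ α ≤ 1`, `(det A)^α (det B)^{1−α} ≤ det(αA + (1 − α)B)`.  Proof: Minkowski's
determinant inequality (in-tree `det_rpow_add_det_rpow_le`) for `αA` and `(1 − α)B`, homogeneity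
`det_smul_rpow`, and the weighted AM–GM inequality on the `N`-th roots; the empty index type is
the trivial `1 ≤ 1`. -/
theorem det_rpow_mul_det_rpow_le {A B : Matrix n n ℝ} (hA : A.PosSemidef) (hB : B.PosSemidef)
    {α : ℝ} (h0 : 0 ≤ α) (h1 : α ≤ 1) :
    A.det ^ α * B.det ^ (1 - α) ≤ (α • A + (1 - α) • B).det := by
  have h1' : 0 ≤ 1 - α := sub_nonneg.2 h1
  rcases isEmpty_or_nonempty n with hn | hn
  · simp [Matrix.det_isEmpty]
  have hS : (α • A + (1 - α) • B).PosSemidef := (hA.smul h0).add (hB.smul h1')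
  have hM := det_rpow_add_det_rpow_le (hA.smul h0) (hB.smul h1')
  rw [det_smul_rpow hA.det_nonneg h0, det_smul_rpow hB.det_nonneg h1'] at hM
  exact rpow_mul_rpow_le_of_roots Fintype.card_ne_zero hA.det_nonneg hB.det_nonneg hS.det_nonneg
    h0 h1' hM

/-- The case `B = I` of (7.6.9a) — the diagonal core of Horn–Johnson's proof of Theorem 7.6.6
[cite: HornJohnson2013, Theorem 7.6.6 (proof, the scalar inequality after (7.6.7))]: for `M ⪰ 0` and
`0 ≤ α ≤ 1`, `(det M)^α ≤ det(αM + (1 − α)I)`. -/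
theorem rpow_det_le_det_convexCombo_one {M : Matrix n n ℝ} (hM : M.PosSemidef) {α : ℝ}
    (h0 : 0 ≤ α) (h1 : α ≤ 1) : M.det ^ α ≤ (α • M + (1 - α) • (1 : Matrix n n ℝ)).det := by
  have h := det_rpow_mul_det_rpow_le hM Matrix.PosSemidef.one h0 h1
  simpa [Matrix.det_one, Real.one_rpow] using h

/-- **(7.6.9b)** [cite: HornJohnson2013, Corollary 7.6.8 ((7.6.9b))]: for positive semidefinite
real symmetric `A, B`, `√(det A · det B) ≤ det((A + B)/2)` — the case `α = 1/2` of (7.6.9a). -/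
theorem sqrt_det_mul_det_le {A B : Matrix n n ℝ} (hA : A.PosSemidef) (hB : B.PosSemidef) :
    Real.sqrt (A.det * B.det) ≤ ((1 / 2 : ℝ) • (A + B)).det := by
  have h := det_rpow_mul_det_rpow_le hA hB (α := 1 / 2) (by norm_num) (by norm_num)
  rw [show (1 : ℝ) - 1 / 2 = 1 / 2 by norm_num, ← smul_add] at h
  rwa [Real.sqrt_eq_rpow, Real.mul_rpow hA.det_nonneg hB.det_nonneg]

omit [Fintype n] [DecidableEq n] in
/-- The positive definite real symmetric matrices form a convex set
[cite: HornJohnson2013, Observation 7.1.3]: a nonnegative combination of positive semidefinite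
matrices in which some positive definite term carries a positive weight is positive definite.
(The tree's `convex_setOf_posSemidef` is the semidefinite cone.) -/
theorem convex_setOf_posDef : Convex ℝ {A : Matrix n n ℝ | A.PosDef} := by
  intro A hA B hB a b ha hb hab
  simp only [Set.mem_setOf_eq] at hA hB ⊢
  rcases ha.eq_or_lt with rfl | ha'
  · rw [zero_add] at hab; subst hab; simpa using hB
  · exact (hA.smul ha').add_posSemidef (hB.posSemidef.smul hb)

/-- **Horn–Johnson Theorem 7.6.6 (concavity of `log det`)** [cite: HornJohnson2013, Theorem 7.6.6
((7.6.7))]: `A ↦ log det A` is concave on the convex set of positive definite real symmetric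
matrices, i.e. `a log det A + b log det B ≤ log det(aA + bB)` for `a, b ≥ 0`, `a + b = 1` — the
logarithm of Ky Fan's inequality (7.6.9a).  (Strictness is not formalised.  On the SEMIdefinite
cone the statement would be false with Lean's `Real.log 0 = 0`, hence the definite cone.) -/
theorem concaveOn_log_det :
    ConcaveOn ℝ {A : Matrix n n ℝ | A.PosDef} (fun A ↦ Real.log A.det) := by
  refine ⟨convex_setOf_posDef, ?_⟩
  intro A hA B hB a b ha hb hab
  simp only [Set.mem_setOf_eq] at hA hB
  have hb' : b = 1 - a := by linarith
  have ha1 : a ≤ 1 := by linarith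
  have hkey := det_rpow_mul_det_rpow_le hA.posSemidef hB.posSemidef ha ha1
  rw [← hb'] at hkey
  have hpos : 0 < A.det ^ a * B.det ^ b :=
    mul_pos (Real.rpow_pos_of_pos hA.det_pos a) (Real.rpow_pos_of_pos hB.det_pos b)
  simp only [smul_eq_mul]
  calc a * Real.log A.det + b * Real.log B.det
      = Real.log (A.det ^ a * B.det ^ b) := by
        rw [Real.log_mul (Real.rpow_pos_of_pos hA.det_pos a).ne'
          (Real.rpow_pos_of_pos hB.det_pos b).ne', Real.log_rpow hA.det_pos,
          Real.log_rpow hB.det_pos]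
    _ ≤ Real.log (a • A + b • B).det := Real.log_le_log hpos hkey

/-- The inequality form of Theorem 7.6.6 [cite: HornJohnson2013, Theorem 7.6.6 ((7.6.7))]:
`α log det A + (1 − α) log det B ≤ log det(αA + (1 − α)B)` for positive definite `A, B` and
`0 ≤ α ≤ 1`. -/
theorem convexCombo_log_det_le {A B : Matrix n n ℝ} (hA : A.PosDef) (hB : B.PosDef) {α : ℝ}
    (h0 : 0 ≤ α) (h1 : α ≤ 1) :
    α * Real.log A.det + (1 - α) * Real.log B.det ≤ Real.log (α • A + (1 - α) • B).det := by
  have h := concaveOn_log_det.2 (x := A) (y := B) hA hB h0 (sub_nonneg.2 h1) (by ring)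
  simpa [smul_eq_mul] using h

/-- **`det A + det B ≤ det(A + B)`** for positive semidefinite real symmetric `A, B` of size
`N ≥ 1` [cite: HornJohnson2013, Theorem 7.8.21 (exercise: "Derive the inequality
`det(A + B) ≥ det A + det B` from (7.8.22)")]: from the in-tree Minkowski inequality and
`a^N + b^N ≤ (a + b)^N` for `a, b ≥ 0`.  (For the empty index type all three determinants are `1`,
so `N ≥ 1` is needed; the tree's `det_le_det_add_of_posSemidef` is the weaker monotonicity.) -/
theorem det_add_det_le_det_add [Nonempty n] {A B : Matrix n n ℝ} (hA : A.PosSemidef)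
    (hB : B.PosSemidef) : A.det + B.det ≤ (A + B).det := by
  have hN : (0 : ℝ) < Fintype.card n := Nat.cast_pos.2 Fintype.card_pos
  have root_pow : ∀ {x : ℝ}, 0 ≤ x →
      (x ^ (1 / (Fintype.card n : ℝ))) ^ (Fintype.card n) = x := fun hx ↦ by
    rw [← Real.rpow_natCast, ← Real.rpow_mul hx, one_div_mul_cancel hN.ne', Real.rpow_one]
  have hmink := det_rpow_add_det_rpow_le hA hB
  have ha : 0 ≤ A.det ^ (1 / (Fintype.card n : ℝ)) := Real.rpow_nonneg hA.det_nonneg _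
  have hb : 0 ≤ B.det ^ (1 / (Fintype.card n : ℝ)) := Real.rpow_nonneg hB.det_nonneg _
  have hpow := pow_le_pow_left₀ (add_nonneg ha hb) hmink (Fintype.card n)
  rw [root_pow (hA.add hB).det_nonneg] at hpow
  calc A.det + B.det
      = (A.det ^ (1 / (Fintype.card n : ℝ))) ^ (Fintype.card n) +
          (B.det ^ (1 / (Fintype.card n : ℝ))) ^ (Fintype.card n) := by
        rw [root_pow hA.det_nonneg, root_pow hB.det_nonneg]
    _ ≤ (A.det ^ (1 / (Fintype.card n : ℝ)) + B.det ^ (1 / (Fintype.card n : ℝ))) ^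
          (Fintype.card n) := pow_add_pow_le ha hb Fintype.card_ne_zero
    _ ≤ (A + B).det := hpow

end Literature.Analysis.Matrix.LogDet
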